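import Summits.CriticalPhenomena.CardyFormulaZ2.Theses.CardyBoundaryCoulombGas
import Literature.Probability.LatticeModels.RowStatePlanar
import Literature.Probability.Percolation.LatticeSymmetry

/-!
# The unmarked block of the planar `⋆`-chain: closure, monotone coupling, pair functionals

Helper for stub `stub_relaxationUpper` (S2a) of line `two-cluster-rate-is-stationary-gap` of crux
`CardyBoundaryCoulombGas.StripClusterRates` (stmt-CriticalPhenomena-13878): the chain-side
bookkeeping that feeds the spectral relaxation bound.

For the deterministic row step `planarRowStep O H` of bond percolation on planar connectivity
patterns (`RowStatePlanar.lean`):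

* `s2a_unmarked_rowStep`, `s2a_unmarked_foldl` — a pattern in which no site is joined to `⋆`
  (UNMARKED) stays unmarked (the vertical layer joins a new site to `⋆` only through an old site
  joined to `⋆`; the horizontal layer only merges site classes); hence the transfer matrix has no
  unmarked → marked entry (`s2a_planarTransfer_unmarked_marked`) and the unmarked block is
  stochastic (`s2a_sum_unmarked_block`);
* `s2a_rowStep_empty_empty` — with every bond closed one step produces the free pattern, so every
  row charges `free` (`s2a_planarTransfer_free_pos`);
* `s2a_rowStep_mono`, `s2a_foldl_mono` — the step is monotone for refinement of partitions (the
  grand / same-bonds coupling is monotone);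
* `s2a_indicator_ne_le_sum` — under the monotone coupling two iterates differ iff some pair of
  SITES is joined in the upper one only, so the disagreement indicator is dominated by the sum over
  site pairs of differences of the increasing pair functionals `1{y ∼ y'}`;
* `s2a_card_disagree_le` — summed over admissible bond words: the disagreement count is at most
  the sum over site pairs of `Z^m [(T^m f_{yy'})(top) - (T^m f_{yy'})(bot)]`, given the
  "power = normalised count" identity for `T = planarTransfer S` as a hypothesis (landed separately
  by the line as `…IterateAverage`).

Sources: Levin–Peres–Wilmer (2009) §5 (grand coupling), Bondesan–Jacobsen–Saleur (2013) §2;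
folklore.
-/

noncomputable section

namespace Summit.CriticalPhenomena.CardyFormulaZ2.Cruxes.StripClusterRates.TwoClusterRateIsStationaryGap

open Filter Topology
open scoped BigOperators Classical Matrix
open Literature.Probability.Percolation Literature.Probability.LatticeModels

/-! ## Unmarked patterns are closed under the dynamics -/

/-- The vertical layer does not join a site to `⋆` unless it was. [folklore] -/
theorem s2a_not_rel_star_vertRel {S : Finset ℤ} (O : Finset S) (σ : Setoid (RowPoint S))
    (hσ : ∀ y : S, ¬ σ (Sum.inl y) (RowPoint.star S)) (y : S) :
    ¬ vertRel O σ (Sum.inl y) (RowPoint.star S) := by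
  rw [vertRel_apply]
  rintro (h | ⟨-, -, h⟩)
  · exact Sum.inl_ne_inr h
  · exact hσ y h

/-- One open horizontal bond does not join a site to `⋆` unless some site was. [folklore] -/
theorem s2a_not_rel_star_joinRel {S : Finset ℤ} (x : S) (σ : Setoid (RowPoint S))
    (hσ : ∀ y : S, ¬ σ (Sum.inl y) (RowPoint.star S)) (y : S) :
    ¬ joinRel x σ (Sum.inl y) (RowPoint.star S) := by
  by_cases hx : (x : ℤ) + 1 ∈ S
  · rw [joinRel_apply x hx]
    rintro (h | ⟨-, h | h⟩)
    · exact hσ y h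
    · exact hσ x (σ.symm' h)
    · exact hσ ⟨(x : ℤ) + 1, hx⟩ (σ.symm' h)
  · rw [joinRel_of_not_mem x hx]
    exact hσ y

/-- The horizontal layer does not join a site to `⋆` unless some site was. [folklore] -/
theorem s2a_not_rel_star_horizRel {S : Finset ℤ} (H : Finset S) (σ : Setoid (RowPoint S))
    (hσ : ∀ y : S, ¬ σ (Sum.inl y) (RowPoint.star S)) (y : S) :
    ¬ horizRel H σ (Sum.inl y) (RowPoint.star S) := by
  induction H using Finset.induction_on generalizing y with
  | empty => rw [horizRel_empty]; exact hσ y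
  | insert x H _ ih =>
    rw [horizRel_insert]
    exact s2a_not_rel_star_joinRel x _ ih y

/-- **Unmarked patterns stay unmarked**: if no site is joined to `⋆`, no site is after a row step.
[folklore] -/
theorem s2a_unmarked_rowStep {S : Finset ℤ} (O H : Finset S) (π : RowState S)
    (hπ : ∀ y, ¬ π.JoinedToStar y) (y : S) : ¬ (rowStep O H π).JoinedToStar y :=
  s2a_not_rel_star_horizRel H _ (s2a_not_rel_star_vertRel O π.rel hπ) y

/-- Unmarked planar patterns stay unmarked along any word of row steps. [folklore] -/
theorem s2a_unmarked_foldl {S : Finset ℤ} (l : List (Finset S × Finset S)) (p : PlanarRowState S)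
    (hp : ∀ y, ¬ p.1.JoinedToStar y) :
    ∀ y, ¬ (l.foldl (fun r OH => planarRowStep OH.1 OH.2 r) p).1.JoinedToStar y := by
  induction l generalizing p with
  | nil => exact hp
  | cons OH l ih =>
    rw [List.foldl_cons]
    exact ih _ (s2a_unmarked_rowStep OH.1 OH.2 p.1 hp)

/-- The free pattern is unmarked. [folklore] -/
theorem s2a_unmarked_free (S : Finset ℤ) (y : S) : ¬ (RowState.free S).JoinedToStar y :=
  fun h => Sum.inl_ne_inr h

/-- **No unmarked → marked transition.** [folklore] -/
theorem s2a_planarTransfer_unmarked_marked {S : Finset ℤ} (p q : PlanarRowState S)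
    (hp : ∀ y, ¬ p.1.JoinedToStar y) (hq : ∃ y, q.1.JoinedToStar y) : planarTransfer S p q = 0 := by
  by_contra h
  unfold planarTransfer PercolationRowTransfer at h
  rw [div_eq_zero_iff, not_or, Nat.cast_eq_zero, Finset.card_eq_zero] at h
  obtain ⟨OH, hOH⟩ := Finset.nonempty_iff_ne_empty.2 h.1
  rw [Finset.mem_filter] at hOH
  obtain ⟨y, hy⟩ := hq
  rw [← hOH.2] at hy
  exact s2a_unmarked_rowStep OH.1 OH.2 p.1 hp y hy

/-- A sum over all planar patterns of a function vanishing on marked ones is the sum over the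
unmarked ones. [folklore] -/
theorem s2a_sum_eq_sum_unmarked {S : Finset ℤ} {M : Type*} [AddCommMonoid M]
    (G : PlanarRowState S → M) (hG : ∀ q, (∃ y, q.1.JoinedToStar y) → G q = 0) :
    ∑ q, G q = ∑ b : {q : PlanarRowState S // ∀ y, ¬ q.1.JoinedToStar y}, G b.1 := by
  rw [← Finset.sum_subtype (Finset.univ.filter fun q : PlanarRowState S => ∀ y, ¬ q.1.JoinedToStar y)
    (by simp) G]
  symm
  refine Finset.sum_filter_of_ne fun q _ hne => ?_
  by_contra hq
  push Not at hq
  exact hne (hG q hq)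

/-- **The unmarked block is stochastic.** [folklore] -/
theorem s2a_sum_unmarked_block {S : Finset ℤ} (a : {q : PlanarRowState S // ∀ y, ¬ q.1.JoinedToStar y}) :
    ∑ b : {q : PlanarRowState S // ∀ y, ¬ q.1.JoinedToStar y}, planarTransfer S a.1 b.1 = 1 := by
  rw [← s2a_sum_eq_sum_unmarked (fun q => planarTransfer S a.1 q)
    (fun q hq => s2a_planarTransfer_unmarked_marked a.1 q a.2 hq)]
  exact sum_planarTransfer_eq_one S a.1

/-! ## Every row charges the free pattern -/

/-- With every bond closed, one row step produces the free pattern. [folklore] -/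
theorem s2a_rowStep_empty_empty {S : Finset ℤ} (π : RowState S) : rowStep ∅ ∅ π = RowState.free S := by
  apply RowState.ext
  show horizRel ∅ (vertRel ∅ π.rel) = ⊥
  rw [horizRel_empty]
  ext a b
  rw [vertRel_apply]
  constructor
  · rintro (rfl | ⟨ha, hb, -⟩)
    · exact rfl
    · cases a with
      | inl x => exact absurd ha (Finset.notMem_empty x)
      | inr u =>
        cases b with
        | inl y => exact absurd hb (Finset.notMem_empty y)
        | inr u' => exact rfl
  · exact fun h => Or.inl h

/-- **Every pattern reaches `free` in one step with probability `≥ 2^{-|S|-|hEdges S|} > 0`.**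
[folklore] -/
theorem s2a_planarTransfer_free_pos {S : Finset ℤ} (p : PlanarRowState S) :
    0 < planarTransfer S p ⟨RowState.free S, RowState.isPlanar_free S⟩ := by
  unfold planarTransfer PercolationRowTransfer
  have hN : (0 : ℝ) < (2 : ℝ) ^ S.card * 2 ^ (hEdges S).card := by positivity
  rw [div_pos_iff_of_pos_right hN, Nat.cast_pos, Finset.card_pos]
  refine ⟨(∅, ∅), ?_⟩
  rw [Finset.mem_filter, Finset.mem_product, Finset.mem_powerset]
  exact ⟨⟨Finset.mem_univ _, Finset.empty_subset _⟩, s2a_rowStep_empty_empty p.1⟩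

/-! ## The monotone (same-bonds) coupling -/

/-- The row step is monotone for refinement of partitions. [folklore] -/
theorem s2a_rowStep_mono {S : Finset ℤ} (O H : Finset S) {π ρ : RowState S} (h : π.rel ≤ ρ.rel) :
    (rowStep O H π).rel ≤ (rowStep O H ρ).rel :=
  show horizRel H (vertRel O π.rel) ≤ horizRel H (vertRel O ρ.rel) from
    sup_le_sup_right (vertRel_mono O h) _

/-- Iterating the same bond word from two comparable patterns keeps them comparable. [folklore] -/
theorem s2a_foldl_mono {S : Finset ℤ} (l : List (Finset S × Finset S)) {p q : PlanarRowState S}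
    (h : p.1.rel ≤ q.1.rel) :
    (l.foldl (fun r OH => planarRowStep OH.1 OH.2 r) p).1.rel ≤
      (l.foldl (fun r OH => planarRowStep OH.1 OH.2 r) q).1.rel := by
  induction l generalizing p q with
  | nil => exact h
  | cons OH l ih =>
    simp only [List.foldl_cons]
    exact ih (s2a_rowStep_mono OH.1 OH.2 h)

/-- The free pattern is the bottom of the refinement order. [folklore] -/
theorem s2a_free_rel_le {S : Finset ℤ} (p : PlanarRowState S) : (RowState.free S).rel ≤ p.1.rel :=
  bot_le

/-- **Disagreement is seen by a pair of sites.** If `F ≤ A` (refinement) and `A` is unmarked, then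
`1{A ≠ F} ≤ ∑_{(y,y')} (1{y ∼_A y'} - 1{y ∼_F y'})`, every summand being nonnegative. [folklore] -/
theorem s2a_indicator_ne_le_sum {S : Finset ℤ} (A F : PlanarRowState S) (hle : F.1.rel ≤ A.1.rel)
    (hA : ∀ y, ¬ A.1.JoinedToStar y) :
    (if A ≠ F then (1 : ℝ) else 0) ≤
      ∑ pr : S × S, ((if A.1.rel (Sum.inl pr.1) (Sum.inl pr.2) then (1 : ℝ) else 0) -
        (if F.1.rel (Sum.inl pr.1) (Sum.inl pr.2) then (1 : ℝ) else 0)) := by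
  have hnn : ∀ pr : S × S, 0 ≤ (if A.1.rel (Sum.inl pr.1) (Sum.inl pr.2) then (1 : ℝ) else 0) -
      (if F.1.rel (Sum.inl pr.1) (Sum.inl pr.2) then (1 : ℝ) else 0) := by
    intro pr
    by_cases hF : F.1.rel (Sum.inl pr.1) (Sum.inl pr.2)
    · rw [if_pos hF, if_pos (hle hF)]
      norm_num
    · rw [if_neg hF]
      split_ifs <;> norm_num
  split_ifs with hAF
  · -- a separating pair of row points …
    obtain ⟨a, b, hab, hnab⟩ : ∃ a b, A.1.rel a b ∧ ¬ F.1.rel a b := by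
      by_contra hcon
      push Not at hcon
      apply hAF
      apply Subtype.ext
      apply RowState.ext
      exact le_antisymm (fun a b h => hcon a b h) hle
    -- … consists of two sites, `A` being unmarked
    obtain ⟨y, rfl⟩ : ∃ y, a = Sum.inl y := by
      cases a with
      | inl y => exact ⟨y, rfl⟩
      | inr u =>
        exfalso
        cases b with
        | inl y' => exact hA y' (A.1.rel.symm' hab)
        | inr u' => exact hnab (F.1.rel.refl' _)
    obtain ⟨y', rfl⟩ : ∃ y', b = Sum.inl y' := by
      cases b with
      | inl y' => exact ⟨y', rfl⟩
      | inr u => exact absurd hab (hA y)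
    calc (1 : ℝ) = (if A.1.rel (Sum.inl y) (Sum.inl y') then (1 : ℝ) else 0) -
          (if F.1.rel (Sum.inl y) (Sum.inl y') then (1 : ℝ) else 0) := by
          rw [if_pos hab, if_neg hnab]; norm_num
      _ ≤ ∑ pr : S × S, ((if A.1.rel (Sum.inl pr.1) (Sum.inl pr.2) then (1 : ℝ) else 0) -
            (if F.1.rel (Sum.inl pr.1) (Sum.inl pr.2) then (1 : ℝ) else 0)) :=
          Finset.single_le_sum (f := fun pr : S × S =>
            (if A.1.rel (Sum.inl pr.1) (Sum.inl pr.2) then (1 : ℝ) else 0) -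
              (if F.1.rel (Sum.inl pr.1) (Sum.inl pr.2) then (1 : ℝ) else 0))
            (fun pr _ => hnn pr) (Finset.mem_univ (y, y'))
  · exact Finset.sum_nonneg fun pr _ => hnn pr

/-! ## Summing over bond words: the disagreement count against pair functionals -/

/-- **Disagreement count ≤ pair functionals.** For `bot ≤ top` with `top` unmarked, the number of
admissible bond words of length `m` on which the iterates from `top` and from `bot` disagree is at
most `∑_{(y,y')} Z^m [(T^m f_{yy'})(top) - (T^m f_{yy'})(bot)]`, `f_{yy'} = 1{y ∼ y'}`,
`Z = 2^|S| 2^|hEdges S|`, GIVEN the identity "`T^m *ᵥ g` = normalised sum of `g ∘ iterate` over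
admissible words" (hypothesis `havg`). [folklore] -/
theorem s2a_card_disagree_le (S : Finset ℤ) (m : ℕ) (top bot : PlanarRowState S)
    (hle : bot.1.rel ≤ top.1.rel) (htop : ∀ y, ¬ top.1.JoinedToStar y)
    (havg : ∀ (g : PlanarRowState S → ℝ) (p : PlanarRowState S),
      (planarTransfer S ^ m *ᵥ g) p =
        (∑ seq ∈ Fintype.piFinset (fun _ : Fin m =>
            (Finset.univ : Finset (Finset S)) ×ˢ (hEdges S).powerset),
          g ((List.ofFn seq).foldl (fun r OH => planarRowStep OH.1 OH.2 r) p)) /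
          ((2 : ℝ) ^ S.card * 2 ^ (hEdges S).card) ^ m) :
    ((((Fintype.piFinset fun _ : Fin m =>
          (Finset.univ : Finset (Finset S)) ×ˢ (hEdges S).powerset).filter
        fun seq =>
          (List.ofFn seq).foldl (fun r OH => planarRowStep OH.1 OH.2 r) top ≠
            (List.ofFn seq).foldl (fun r OH => planarRowStep OH.1 OH.2 r) bot).card : ℝ) /
        ((2 : ℝ) ^ S.card * 2 ^ (hEdges S).card) ^ m)
      ≤ ∑ pr : S × S,
          ((planarTransfer S ^ m *ᵥ fun q => if q.1.rel (Sum.inl pr.1) (Sum.inl pr.2) then 1 else 0) top -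
            (planarTransfer S ^ m *ᵥ fun q => if q.1.rel (Sum.inl pr.1) (Sum.inl pr.2) then 1 else 0)
              bot) := by
  set Z : ℝ := ((2 : ℝ) ^ S.card * 2 ^ (hEdges S).card) ^ m with hZ
  have hZpos : 0 < Z := by rw [hZ]; positivity
  set seqs := Fintype.piFinset fun _ : Fin m =>
    (Finset.univ : Finset (Finset S)) ×ˢ (hEdges S).powerset with hseqs
  set iter : (Fin m → Finset S × Finset S) → PlanarRowState S → PlanarRowState S :=
    fun seq p => (List.ofFn seq).foldl (fun r OH => planarRowStep OH.1 OH.2 r) p with hiter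
  set ind : S × S → PlanarRowState S → ℝ :=
    fun pr q => if q.1.rel (Sum.inl pr.1) (Sum.inl pr.2) then 1 else 0 with hind
  -- sums of `g ∘ iterate` are `Z` times the matrix power
  have hsum : ∀ (g : PlanarRowState S → ℝ) (p : PlanarRowState S),
      ∑ seq ∈ seqs, g (iter seq p) = Z * (planarTransfer S ^ m *ᵥ g) p := by
    intro g p
    rw [havg g p, mul_div_cancel₀ _ hZpos.ne']
  change (((seqs.filter fun seq => iter seq top ≠ iter seq bot).card : ℝ) / Z) ≤
    ∑ pr : S × S, ((planarTransfer S ^ m *ᵥ ind pr) top - (planarTransfer S ^ m *ᵥ ind pr) bot)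
  rw [div_le_iff₀ hZpos, Finset.natCast_card_filter, Finset.sum_mul]
  calc ∑ seq ∈ seqs, (if iter seq top ≠ iter seq bot then (1 : ℝ) else 0)
      ≤ ∑ seq ∈ seqs, ∑ pr : S × S, (ind pr (iter seq top) - ind pr (iter seq bot)) :=
        Finset.sum_le_sum fun seq _ =>
          s2a_indicator_ne_le_sum (iter seq top) (iter seq bot) (s2a_foldl_mono _ hle)
            (s2a_unmarked_foldl _ top htop)
    _ = ∑ pr : S × S, ∑ seq ∈ seqs, (ind pr (iter seq top) - ind pr (iter seq bot)) :=
        Finset.sum_comm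
    _ = ∑ pr : S × S, ((planarTransfer S ^ m *ᵥ ind pr) top -
          (planarTransfer S ^ m *ᵥ ind pr) bot) * Z := by
        refine Finset.sum_congr rfl fun pr _ => ?_
        rw [Finset.sum_sub_distrib, hsum (ind pr) top, hsum (ind pr) bot]
        ring

/-- **Registered form** of `s2a_card_disagree_le` (`Matrix.mulVec` spelled out): the disagreement
count of the monotone coupling from `top ≥ bot` (`top` unmarked) is dominated by the pair
functionals, given the "power = normalised count" identity. [folklore] -/
theorem s2a_disagree_le_pairSum : ∀ (S : Finset ℤ) (m : ℕ) (top bot : PlanarRowState S),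
    bot.1.rel ≤ top.1.rel → (∀ y, ¬ top.1.JoinedToStar y) →
    (∀ (g : PlanarRowState S → ℝ) (p : PlanarRowState S),
      (planarTransfer S ^ m).mulVec g p =
        (∑ seq ∈ Fintype.piFinset (fun _ : Fin m =>
            (Finset.univ : Finset (Finset S)) ×ˢ (hEdges S).powerset),
          g ((List.ofFn seq).foldl (fun r OH => planarRowStep OH.1 OH.2 r) p)) /
          ((2 : ℝ) ^ S.card * 2 ^ (hEdges S).card) ^ m) →
    ((((Fintype.piFinset fun _ : Fin m =>
          (Finset.univ : Finset (Finset S)) ×ˢ (hEdges S).powerset).filter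
        fun seq =>
          (List.ofFn seq).foldl (fun r OH => planarRowStep OH.1 OH.2 r) top ≠
            (List.ofFn seq).foldl (fun r OH => planarRowStep OH.1 OH.2 r) bot).card : ℝ) /
        ((2 : ℝ) ^ S.card * 2 ^ (hEdges S).card) ^ m)
      ≤ ∑ pr : S × S,
          ((planarTransfer S ^ m).mulVec (fun q => if q.1.rel (Sum.inl pr.1) (Sum.inl pr.2) then 1 else 0) top -
            (planarTransfer S ^ m).mulVec (fun q => if q.1.rel (Sum.inl pr.1) (Sum.inl pr.2) then 1 else 0)
              bot) :=
  fun S m top bot hle htop havg => s2a_card_disagree_le S m top bot hle htop havg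

end Summit.CriticalPhenomena.CardyFormulaZ2.Cruxes.StripClusterRates.TwoClusterRateIsStationaryGap

end
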